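import Summits.QuantumFields.BalabanUV.Beta.SymmetrisedAxialPotential
import Literature.MathematicalPhysics.QuantumFieldTheory.Balaban1983to89.Beta.AveragingHessianKernelsRooted

/-!
# `BalabanUV.Beta.SymAveragingHessianCounts` — binder row D1, TABLES-SYM step S2a (an1): THE `(σ,σ′)`-PAIR LOOP WORDS OF THE
# (0.4)-SYMMETRISED ONE-STEP AVERAGING AND THEIR ORDER-≤2 INTEGER COUNT TABLES `symLinCountAt ∕ symHessCountAt ∕ symVhCountAt`
# (weight `(d!)²`), with support, entry bounds, block-translation covariance, the real kernels and the packed stencil families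
# `symVhSAt` (sym twin of `vhSAt ρ`, letters (LV)(TV)) and `symHessFFAt` (sym twin of `hessFFAt ρ`, letters (LH)(TH))

HONEST FRAMING (cell contract, verbatim): «discharging `BetaPertH` makes Bałaban's UV stability UNCONDITIONAL — a real constructive-QFT
result; it is NOT the continuum limit and NOT the Clay problem.»  THIS MODULE DISCHARGES NOTHING of `BetaPertH` ∕ row D1: it is [folklore]
letter-list algebra and box sums on `ℤ^d` — the `S_d × S_d` version of node 7aρ `Beta.AveragingHessianKernelsRooted` (same section plan, same
proofs with the comb `axial` replaced by the permuted comb `axialP σ`).  0 sorry, 0 `def … : Prop`, nothing cited as a fact; quotations are OBJECT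
LOCATORS only.  NOT D1, NOT BetaPertH, NOT continuum, NOT Clay.

WHY.  The (0.4) literal of row D1 (`SymmetrisedStepJets.SymTables`, RULINGS R-D1-g25-1∕-2) consumes FIVE symmetrised tables; the owner's record
`SymTables d Lc` displays them with their letters, and referee C-d1ref44-6 asks an1 for the INSTANCE whose first-order tables `V`, `H` come with
(LV)(TV)(LH)(TH) as theorems.  `SymmetrisedAxialPotential` (S1) typed the FIRST order (`symAxial`, `symLinAvgAt`: plain `Σ_σ` of the comb objects).
At SECOND order the (0.4) mean over `Γ ∈ G(c₋,x)`, `Γ′ ∈ G(c₊,x′)` ([Balaban1987RG1] (0.4) p.253, weights `|G(c₋,x)|⁻¹·|G(c₊,x′)|⁻¹`) does NOT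
factor: the BCH cross terms pair the lower contour of order `σ` with the upper contour of order `σ′ ≠ σ` (R-D1-g25-1 (4)(R1); an1 TABLES-SYM step 2,
exact check `c5`), so the second-order tables are sums over the PAIR family `{loop^{σ,σ′}_x : x ∈ B(y), (σ,σ′) ∈ S_d²}` of node 7a's per-loop
functionals, at the common weight `(d!)²` (a contour moving `m` axes arises from `d!∕m!` orders, so the uniform mean over orders IS the mean over
`G(y,x)` — [analysis]).  This file types exactly that, generically in `d` and over any coefficient group, so that node 7a's identification ∕ support ∕
bound ∕ packing lemmas apply verbatim.

WHAT ([folklore] throughout; «sym twin of X» = X of node 7aρ with `Σ_x F(loop_x)` replaced by `Σ_x Σ_{σ,σ′} F(loop^{σ,σ′}_x)` and the linear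
functional `Z = linAvgAt ρ` by `S = Σ_σ Σ_x (letters of γ^{σ,σ}_x)` = `d!·L^d·`(the (0.4) mean); normalisations recorded at each `def`).
* §1 `P1g σ A` — the pull-back `(P1g σ A)_κ(x) = A_{σκ}(σ•x)` over ANY coefficient group (`= ResolventPermutation.P1` on `ℝ`, `rfl`); `axialP σ A y x`
  — the letter list of the comb of axis order `σ` from `y` to `x` (`(axialP σ A y x).sum = SymmetrisedAxialPotential.axialPerm σ A y x`, `rfl`);
  naturality, exact forms, translation, and SUPPORT `lettersIn_axialP : LettersIn A (Hull y x) (axialP σ A y x)`.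
* §2 the pair words `gammaPAt σ σ′ ρ A L μ y b = axialP σ (r → x) ++ segUp (x, μ, L) ++ rev (axialP σ′ (r′ → x′))`, `loopPAt = gammaPAt ++ rev (segUp
  (r, μ, L))` (`r = L·y + ρ`, `x = L·y + b`, primes `= + L·e_μ`; node 5ρ's `gammaCAt`∕`loopCAt` are the instance `σ = σ′ = 1`, `rfl`); naturality,
  exact forms (`loopPAt_sum_grad = 0`), block translation.
* §3 the functionals `symLinU` (= `symLinAvgAt` on `ℝ`, theorem `symLinU_real`), `symHessUAt`, `symVhUAt` over any ring and the INTEGER COUNT TABLES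
  `symLinCountAt`, `symWedgeCountAt`, `symHessCountAt`, `symVhCountAt`; the single-bond IDENTIFICATION theorems `symHessUAt_single`,
  `symVhUAt_single`; antisymmetry.
* §4 support in node 7a's box `Near L y` (box root); §5 entry bounds (`ell d L = (2d+2)L`); §6 block-translation covariance; §7 the real kernels
  `symLinKerAt = symLinCountAt∕(d!·L^d)`, `symHessKerAt = symHessCountAt∕(2(d!)²L^d)`, `symVhKerAt = symVhCountAt∕(2(d!)²L^{2d})`, and the BRIDGE
  `symLinKerAt_eq_symLinAvgAt` to the (0.4) linear kernel of record (`= the body of DshAn1.lin04KerAt` at dimension `d+1`).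
* §8 packing with node 7a's `packVH`: `symVhSAt ρ d L` with **(LV) `locStencil_symVhSAt`** (every `δ ≥ 0`, constant `3ℓ²·e^{4(d+1)Lδ}` —
  the SAME as the comb's) and **(TV) `symVhSAt_translate`**; the `(inl,inl)`-block kernel `symHessFFAt ρ L μ y` with **(LH)
  `vertexFamily_symHessFFAt`** (every `δ ≥ 0`, `2ℓ²·e^{4(d+1)Lδ}`) and **(TH) `symHessFFAt_translate`**; and the four letters in the EXACT field
  shapes of `SymmetrisedStepJets.SymTables` (`hV`, `hVt`, `hH`, `hHt` with `Lc = L`): `symVhSAt_hV`, `symVhSAt_hVt`, `symHessFFAt_hH`,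
  `symHessFFAt_hHt` (and the `_ctr` forms at the centred root with only `1 ≤ L`, plus (V-ff0) `symVhSAt_hV0_ctr`) — i.e. the types and
  letters of the record fields `V := symVhSAt ρ_c d Lc`, `H := symHessFFAt ρ_c Lc`; and, for a multiplier table `M j := c_j • symHessFFAt ρ_c Lc`
  (the owner's weight `c_j` left generic), the letters (LM)(TM) `smul_symHessFFAt_hM_ctr` ∕ `smul_symHessFFAt_hMt_ctr`.
* §9 decided toy entries at `d = 1`, `L = 3`, centred root (one axial order: the symmetrised tables ARE node 7aρ's, same numbers).  The `d ≥ 2`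
  tables are NOT decided here; an1's exact engine of record (`symassemble2.py`, gen 33, sha16 43f3ae929be7fe20; files
  `symtables2_D{D}_n{n}_mu{μ}.json.gz`) tabulates them with the dictionary `LIN = d!·symLinCountAt`, `C = (d!)²·cCountAt`, `HESS = symHessCountAt`,
  `VH = symVhCountAt`, `WED = symWedgeCountAt`, `denominator = (d!)²` (root `ρ = ctr`, coarse `y = 0`; Lean `σ` ↔ engine order `(σ(d−1),…,σ(0))`) —
  a CLAIM about a script, checked by an1 gen 40 (`c5`) on `D ∈ {2,3}`, not a kernel fact.
NOT HERE: the multiplier ∕ second-order-border ∕ mixed tables `M`, `vh₂S`, `mixFF` of the record (S2b), the reflection and row letters of the root END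
`DshAn1End` for the instance (S2c), any identification with Bałaban's minimisers ∕ propagators ∕ β, any estimate beyond the trivial entry bounds.
HONEST DEPENDENCY (verbatim): «continuum YM on T⁴ ⇐ BetaPertH ∧ nine spine estimates (0/9 proved); BetaPertH ⇐ (D1) ∧ (D4) ∧ CAP+tail;
G-an2-4 gates asym, D1 and NE2/3/4.»  ABSOLUTE RULE (cell, verbatim): «No internally-minted statement may enter as a cited fact. Every
hypothesis is either kernel-proved in this package or a verbatim quotation of a PUBLISHED theorem with page reference.»
Provenance: β sub-cell, W-supplier `b2b-balaban-beta-an1` gen 41 (scratch for courier by the row-D1 owner), 2026-08-21; over node 7a∕7aρ, node 5∕5ρ,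
`KernelPermutation`, `ResolventPermutation`, `SymmetrisedAxialPotential` BY NAME; no existing file touched.  Bib keys (locators only):
Balaban1985Averaging, Balaban1987RG1.
COURIER NOTE (b2b-balaban-beta-d1-formalise-leaf-02 gen 12): the gate's `lint.size` (≤ 400 lines) forced a MECHANICAL 3-file split of this module at
its own section boundaries — part 1 (this file) = §1 PullBack, §2 Words, §3 Functionals + Counts; part 2 `SymAveragingHessianCountsBounds` = §4 Support,
§5 Bounds, §6 Covariance; part 3 `SymAveragingHessianCounts` (the intended module name; importing it yields all three) = §7 RealKernels, §8 Packing,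
§9 Toy.  Same namespace throughout; every declaration byte-identical to an1's scratch 05392941d6166f37 and in the original order (`split_s2a.py`).
-/

namespace Summit.QuantumFields.BalabanUV.Beta.SymAveragingHessianCounts

open Finset
open scoped BigOperators Nat
open Literature.MathematicalPhysics.QuantumFieldTheory.Balaban1983to89.Beta
open Literature.MathematicalPhysics.QuantumFieldTheory.Balaban1983to89.Beta.AffineAveraging
open Literature.MathematicalPhysics.QuantumFieldTheory.Balaban1983to89.Beta.AveragingContours
open Literature.MathematicalPhysics.QuantumFieldTheory.Balaban1983to89.Beta.AveragingContoursRooted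
open Literature.MathematicalPhysics.QuantumFieldTheory.Balaban1983to89.Beta.TransportedContourVariables
open Literature.MathematicalPhysics.QuantumFieldTheory.Balaban1983to89.Beta.AveragingHessianKernels
open Literature.MathematicalPhysics.QuantumFieldTheory.Balaban1983to89.Beta.AveragingHessianKernelsRooted
open Summit.QuantumFields.BalabanUV.Beta.KernelPermutation (psite psite_apply psite_symm_apply psite_add psite_sub psite_smul)
open Summit.QuantumFields.BalabanUV.Beta.ResolventPermutation (P1 P1_apply psite_unitVec sum_box_psite toSite_psite psite_block psite_mem_box)
open Summit.QuantumFields.BalabanUV.Beta.SymmetrisedAxialPotential (axialPerm symAxial symLinAvgAt card_perm_fin psite_symm_add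
  psite_symm_smul psite_symm_unitVec)

variable {d : ℕ}

/-! ## §1 The pull-back of a one-form along an axis permutation (any coefficients) and the permuted comb as a LETTER LIST -/

section PullBack

variable {R R' : Type*}

/-- [folklore] **THE PULL-BACK** `(P1g σ A)_κ(x) := A_{σ κ}(σ•x)` of a one-form with coefficients in any additive group (the cell's
`ResolventPermutation.P1` is the case `R = ℝ`). -/
def P1g (σ : Equiv.Perm (Fin d)) (A : Form1 d R) : Form1 d R := fun κ x => A (σ κ) (psite σ x)

/-- [folklore] Entries of the pull-back. -/
@[simp] theorem P1g_apply (σ : Equiv.Perm (Fin d)) (A : Form1 d R) (κ : Fin d) (x : Site d) :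
    P1g σ A κ x = A (σ κ) (psite σ x) := rfl

/-- [folklore] BRIDGE: on real forms `P1g = ResolventPermutation.P1` (`rfl`). -/
theorem P1g_real (σ : Equiv.Perm (Fin d)) (A : Form1 d ℝ) : P1g σ A = P1 σ A := rfl

/-- [folklore] The identity permutation pulls back trivially. -/
@[simp] theorem P1g_one (A : Form1 d R) : P1g 1 A = A := rfl

/-- [folklore] Pull-back of a pair form is the pair of pull-backs. -/
theorem P1g_pairForm (σ : Equiv.Perm (Fin d)) (B A : Form1 d R) : P1g σ (pairForm B A) = pairForm (P1g σ B) (P1g σ A) := rfl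

/-- [folklore] Pull-back and translation: `P1g σ (shift v A) = shift (σ⁻¹•v) (P1g σ A)`. -/
theorem P1g_shift (σ : Equiv.Perm (Fin d)) (v : Site d) (A : Form1 d R) :
    P1g σ (shift v A) = shift ((psite σ).symm v) (P1g σ A) := by
  funext κ z
  simp only [shift, P1g_apply, psite_add, Equiv.apply_symm_apply]

variable [AddCommGroup R] [AddCommGroup R']

/-- [folklore] Naturality in the coefficients. -/
theorem mapForm_P1g (ψ : R →+ R') (σ : Equiv.Perm (Fin d)) (A : Form1 d R) : mapForm ψ (P1g σ A) = P1g σ (mapForm ψ A) := rfl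

/-- [folklore] Additivity (differences). -/
theorem P1g_sub (σ : Equiv.Perm (Fin d)) (A A' : Form1 d R) : P1g σ (A - A') = P1g σ A - P1g σ A' := rfl

/-- [folklore] The pull-back of an exact form is exact. -/
theorem P1g_grad (σ : Equiv.Perm (Fin d)) (f : Site d → R) : P1g σ (grad f) = grad (fun x => f (psite σ x)) := by
  funext κ z
  simp only [grad, P1g_apply, psite_add, psite_unitVec]

/-- [our object] **THE COMB OF AXIS ORDER `σ` AS A LETTER LIST**: `axialP σ A y x` := the cell's comb letter list (`AveragingContours.axial`,
axis order `d−1, …, 0`) of the pulled-back form between the pulled-back endpoints — it moves the axes of `x − y` in the order `σ(d−1), …, σ(0)`;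
its sum is `SymmetrisedAxialPotential.axialPerm σ A y x` (`rfl`). -/
def axialP (σ : Equiv.Perm (Fin d)) (A : Form1 d R) (y x : Site d) : List R :=
  axial (P1g σ A) ((psite σ).symm y) ((psite σ).symm x)

/-- [folklore] The identity order gives back the cell's comb letter list (`rfl`). -/
@[simp] theorem axialP_one (A : Form1 d R) (y x : Site d) : axialP 1 A y x = axial A y x := rfl

/-- [folklore] BRIDGE (first order, S1): `(axialP σ A y x).sum = axialPerm σ A y x` on real forms (`rfl`). -/
theorem axialP_sum_real (σ : Equiv.Perm (Fin d)) (A : Form1 d ℝ) (y x : Site d) : (axialP σ A y x).sum = axialPerm σ A y x := rfl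

/-- [folklore] Naturality of `axialP` in the coefficients. -/
theorem axialP_map (ψ : R →+ R') (σ : Equiv.Perm (Fin d)) (A : Form1 d R) (y x : Site d) :
    (axialP σ A y x).map ψ = axialP σ (mapForm ψ A) y x := by
  rw [axialP, axial_map]; rfl

/-- [folklore] **EXACT FORMS**: every comb from `y` to `x` telescopes, `Σ letters = f x − f y` for `A = grad f`. -/
theorem axialP_sum_grad (σ : Equiv.Perm (Fin d)) (f : Site d → R) (y x : Site d) : (axialP σ (grad f) y x).sum = f x - f y := by
  simp only [axialP, P1g_grad, axial_sum_grad, Equiv.apply_symm_apply]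

/-- [folklore] Linearity in the form (differences). -/
theorem axialP_sum_sub (σ : Equiv.Perm (Fin d)) (A A' : Form1 d R) (y x : Site d) :
    (axialP σ (A - A') y x).sum = (axialP σ A y x).sum - (axialP σ A' y x).sum := by
  simp only [axialP, P1g_sub, axial_sum_sub]

/-- [folklore] The empty comb. -/
@[simp] theorem axialP_self (σ : Equiv.Perm (Fin d)) (A : Form1 d R) (y : Site d) : axialP σ A y y = [] := by
  simp only [axialP, axial_self]

/-- [folklore] Translation covariance: `axialP σ A (y+v) (x+v) = axialP σ (shift v A) y x`. -/
theorem axialP_add (σ : Equiv.Perm (Fin d)) (A : Form1 d R) (y x v : Site d) :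
    axialP σ A (y + v) (x + v) = axialP σ (shift v A) y x := by
  simp only [axialP, P1g_shift, psite_symm_add, ← axial_add]

/-- [folklore] Letters of a pulled-back form based in a region `P` are letters of the form based in `σ•P`. -/
theorem LettersIn.of_P1g {σ : Equiv.Perm (Fin d)} {A : Form1 d R} {P : Site d → Prop} {l : List R}
    (h : LettersIn (P1g σ A) P l) : LettersIn A (fun x' => P ((psite σ).symm x')) l := fun a ha => by
  obtain ⟨κ, w, hw, h⟩ := h a ha
  exact ⟨σ κ, psite σ w, by simpa only [Equiv.symm_apply_apply] using hw, h⟩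

/-- [folklore] **SUPPORT OF THE PERMUTED COMB**: every letter of `axialP σ A y x` is `± A_κ(x′)` with `x′` in the coordinatewise hull of `y`, `x`
(the hull is permutation invariant). -/
theorem lettersIn_axialP (σ : Equiv.Perm (Fin d)) (A : Form1 d R) (y x : Site d) : LettersIn A (Hull y x) (axialP σ A y x) := by
  refine (LettersIn.of_P1g (lettersIn_axial (P1g σ A) ((psite σ).symm y) ((psite σ).symm x))).mono fun x' hx' i => ?_
  simpa only [Hull, psite_symm_apply, Equiv.apply_symm_apply] using hx' (σ.symm i)

/-- [folklore] On the block, from a root inside the block: `|axialP σ| ≤ d·(L − 1)`. -/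
theorem axialP_length_root_block (σ : Equiv.Perm (Fin d)) (A : Form1 d R) (z : Site d) {L : ℕ} {r b : Fin d → ℕ}
    (hr : ∀ i, r i < L) (hb : ∀ i, b i < L) : (axialP σ A (z + toSite r) (z + toSite b)).length ≤ d * (L - 1) := by
  have e : ∀ c : Fin d → ℕ, (psite σ).symm (z + toSite c) = (psite σ).symm z + toSite (fun i => c (σ i)) := fun c => rfl
  rw [axialP, e, e]
  exact axial_length_root_block _ _ (fun i => hr _) (fun i => hb _)

end PullBack

/-! ## §2 The `(σ,σ′)`-pair contour words of the (0.4) averaging, rooted -/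

section Words

variable {R R' : Type*} [AddCommGroup R] [AddCommGroup R']

/-- [our object] **THE PAIR WORD `γ^{σ,σ′}_x`** for the coarse bond `c = ⟨r, r + L·e_μ⟩`, root `r = L·y + ρ`, fine point `x = L·y + b`:
`Γ^σ_{r,x} ∪ [x, x + L·e_μ] ∪ (Γ^{σ′}_{r + L·e_μ, x + L·e_μ})⁻¹` — node 5ρ's `gammaCAt` with the lower comb of order `σ` and the upper comb of order
`σ′` ([Balaban1987RG1] (0.4): `Γ ∈ G(c₋,x)`, `Γ′ ∈ G(c₊,x′)` independent). -/
def gammaPAt (σ σ' : Equiv.Perm (Fin d)) (ρ : Site d) (A : Form1 d R) (L : ℕ) (μ : Fin d) (y : Site d) (b : Fin d → ℕ) :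
    List R :=
  axialP σ A ((L : ℤ) • y + ρ) ((L : ℤ) • y + toSite b)
    ++ segUp A ((L : ℤ) • y + toSite b) μ L
    ++ rev (axialP σ' A ((L : ℤ) • y + ρ + (L : ℤ) • unitVec μ) ((L : ℤ) • y + toSite b + (L : ℤ) • unitVec μ))

/-- [our object] **THE CLOSED PAIR LOOP** `γ^{σ,σ′}_x ∪ (−c)`: back to the root along the reversed straight coarse bond. -/
def loopPAt (σ σ' : Equiv.Perm (Fin d)) (ρ : Site d) (A : Form1 d R) (L : ℕ) (μ : Fin d) (y : Site d) (b : Fin d → ℕ) :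
    List R :=
  gammaPAt σ σ' ρ A L μ y b ++ rev (segUp A ((L : ℤ) • y + ρ) μ L)

/-- [folklore] BRIDGE: the comb pair `σ = σ′ = 1` is node 5ρ's `gammaCAt` (`rfl`). -/
@[simp] theorem gammaPAt_one_one (ρ : Site d) (A : Form1 d R) (L : ℕ) (μ : Fin d) (y : Site d) (b : Fin d → ℕ) :
    gammaPAt 1 1 ρ A L μ y b = gammaCAt ρ A L μ y b := rfl

/-- [folklore] BRIDGE: the comb pair `σ = σ′ = 1` is node 5ρ's `loopCAt` (`rfl`). -/
@[simp] theorem loopPAt_one_one (ρ : Site d) (A : Form1 d R) (L : ℕ) (μ : Fin d) (y : Site d) (b : Fin d → ℕ) :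
    loopPAt 1 1 ρ A L μ y b = loopCAt ρ A L μ y b := rfl

/-- [folklore] Naturality of `gammaPAt` in the coefficients. -/
theorem gammaPAt_map (ψ : R →+ R') (σ σ' : Equiv.Perm (Fin d)) (ρ : Site d) (A : Form1 d R) (L : ℕ) (μ : Fin d) (y : Site d)
    (b : Fin d → ℕ) : (gammaPAt σ σ' ρ A L μ y b).map ψ = gammaPAt σ σ' ρ (mapForm ψ A) L μ y b := by
  simp only [gammaPAt, List.map_append, axialP_map, segUp_map, rev_map]

/-- [folklore] Naturality of `loopPAt` in the coefficients. -/
theorem loopPAt_map (ψ : R →+ R') (σ σ' : Equiv.Perm (Fin d)) (ρ : Site d) (A : Form1 d R) (L : ℕ) (μ : Fin d) (y : Site d)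
    (b : Fin d → ℕ) : (loopPAt σ σ' ρ A L μ y b).map ψ = loopPAt σ σ' ρ (mapForm ψ A) L μ y b := by
  simp only [loopPAt, List.map_append, gammaPAt_map, segUp_map, rev_map]

/-- [folklore] LINEARISED GAUGE COVARIANCE from the root, every order pair: for `A = grad f` the word sums to `f(r + L·e_μ) − f(r)`. -/
theorem gammaPAt_sum_grad (σ σ' : Equiv.Perm (Fin d)) (ρ : Site d) (f : Site d → R) (L : ℕ) (μ : Fin d) (y : Site d)
    (b : Fin d → ℕ) :
    (gammaPAt σ σ' ρ (grad f) L μ y b).sum = f ((L : ℤ) • y + ρ + (L : ℤ) • unitVec μ) - f ((L : ℤ) • y + ρ) := by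
  simp only [gammaPAt, List.sum_append, rev_sum, axialP_sum_grad, segUp_sum_grad]
  abel

/-- [folklore] The closed pair loop has zero circulation on exact forms. -/
theorem loopPAt_sum_grad (σ σ' : Equiv.Perm (Fin d)) (ρ : Site d) (f : Site d → R) (L : ℕ) (μ : Fin d) (y : Site d)
    (b : Fin d → ℕ) : (loopPAt σ σ' ρ (grad f) L μ y b).sum = 0 := by
  simp only [loopPAt, List.sum_append, rev_sum, gammaPAt_sum_grad, segUp_sum_grad]
  abel

/-- [folklore] TRANSLATION COVARIANCE: shifting the coarse index `y ↦ y + v` (root offset fixed) reads the translated form `shift (L·v) A`. -/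
theorem gammaPAt_add (σ σ' : Equiv.Perm (Fin d)) (ρ : Site d) (A : Form1 d R) (L : ℕ) (μ : Fin d) (y v : Site d)
    (b : Fin d → ℕ) : gammaPAt σ σ' ρ A L μ (y + v) b = gammaPAt σ σ' ρ (shift ((L : ℤ) • v) A) L μ y b := by
  have e1 : (L : ℤ) • (y + v) = (L : ℤ) • y + (L : ℤ) • v := smul_add _ _ _
  have e2 : (L : ℤ) • y + (L : ℤ) • v + toSite b = ((L : ℤ) • y + toSite b) + (L : ℤ) • v := by abel
  have e2' : (L : ℤ) • y + (L : ℤ) • v + ρ = ((L : ℤ) • y + ρ) + (L : ℤ) • v := by abel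
  have e3 : (L : ℤ) • y + ρ + (L : ℤ) • v + (L : ℤ) • unitVec μ = ((L : ℤ) • y + ρ + (L : ℤ) • unitVec μ) + (L : ℤ) • v := by abel
  have e4 : (L : ℤ) • y + toSite b + (L : ℤ) • v + (L : ℤ) • unitVec μ
      = ((L : ℤ) • y + toSite b + (L : ℤ) • unitVec μ) + (L : ℤ) • v := by abel
  simp only [gammaPAt, e1, e2, e2', e3, e4, axialP_add, segUp_add]

/-- [folklore] Translation covariance of the closed pair loop. -/
theorem loopPAt_add (σ σ' : Equiv.Perm (Fin d)) (ρ : Site d) (A : Form1 d R) (L : ℕ) (μ : Fin d) (y v : Site d)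
    (b : Fin d → ℕ) : loopPAt σ σ' ρ A L μ (y + v) b = loopPAt σ σ' ρ (shift ((L : ℤ) • v) A) L μ y b := by
  have e : (L : ℤ) • y + (L : ℤ) • v + ρ = ((L : ℤ) • y + ρ) + (L : ℤ) • v := by abel
  simp only [loopPAt, gammaPAt_add, smul_add, e, segUp_add]

end Words

/-! ## §3 The symmetrised letter functionals (any ring) and the INTEGER COUNT TABLES at weight `(d!)²` -/

section Functionals

variable {𝔸 : Type*} [Ring 𝔸]

/-- [our object] **THE SYMMETRISED LINEAR LETTER FUNCTIONAL** `S(W) := Σ_σ Σ_{x∈B(y)} W(γ^{σ,σ}_x)` — UNNORMALISED: `= d!·L^d·` the (0.4) mean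
(at linear order the lower∕upper orders decouple, so any pairing of them gives the same sum); on real forms it IS S1's `symLinAvgAt` (`symLinU_real`). -/
def symLinU (ρ : Site d) (W : Form1 d 𝔸) (L : ℕ) (μ : Fin d) (y : Site d) : 𝔸 :=
  ∑ σ : Equiv.Perm (Fin d), ∑ b ∈ box d L, (gammaPAt σ σ ρ W L μ y b).sum

/-- [our object] **THE SYMMETRISED UNNORMALISED W-HESSIAN FUNCTIONAL** (sym twin of node 7aρ `hessUAt`, weight `(d!)²`):
`Σ_x Σ_{σ,σ′} cross(loop^{σ,σ′}_x) + d!·([S W, W′(c)] + [S W′, W(c)]) + (d!)²·L^d·cross(c)`. -/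
def symHessUAt (ρ : Site d) (W W' : Form1 d 𝔸) (L : ℕ) (μ : Fin d) (y : Site d) : 𝔸 :=
  (∑ b ∈ box d L, ∑ σ : Equiv.Perm (Fin d), ∑ σ' : Equiv.Perm (Fin d), cross (loopPAt σ σ' ρ (pairForm W W') L μ y b))
    + (d ! : ℤ) • (comm (symLinU ρ W L μ y) (segUp W' ((L : ℤ) • y + ρ) μ L).sum
        + comm (symLinU ρ W' L μ y) (segUp W ((L : ℤ) • y + ρ) μ L).sum)
    + ((d ! : ℤ) ^ 2 * (L : ℤ) ^ d) • cross (segUp (pairForm W W') ((L : ℤ) • y + ρ) μ L)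

/-- [our object] **THE SYMMETRISED UNNORMALISED FIELD–MULTIPLIER FUNCTIONAL**, product chart (sym twin of node 7aρ `vhUAt`, weight `(d!)²`):
`L^d·symHessUAt + d!·L^d·S([W,B]_bw) − [S W, S B]`. -/
def symVhUAt (ρ : Site d) (W B : Form1 d 𝔸) (L : ℕ) (μ : Fin d) (y : Site d) : 𝔸 :=
  ((L : ℤ) ^ d) • symHessUAt ρ W B L μ y + ((d ! : ℤ) * (L : ℤ) ^ d) • symLinU ρ (bw W B) L μ y
    - comm (symLinU ρ W L μ y) (symLinU ρ B L μ y)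

/-- [folklore] Naturality of `symLinU` in the coefficients. -/
theorem symLinU_mapForm {R R' : Type*} [AddCommGroup R] [AddCommGroup R'] (ψ : R →+ R') (ρ : Site d) (A : Form1 d R) (L : ℕ)
    (μ : Fin d) (y : Site d) :
    (∑ σ : Equiv.Perm (Fin d), ∑ b ∈ box d L, (gammaPAt σ σ ρ (mapForm ψ A) L μ y b).sum)
      = ψ (∑ σ : Equiv.Perm (Fin d), ∑ b ∈ box d L, (gammaPAt σ σ ρ A L μ y b).sum) := by
  simp only [← gammaPAt_map, map_sum, map_list_sum]

/-- [folklore] **BRIDGE TO S1**: on real forms `symLinU ρ A = SymmetrisedAxialPotential.symLinAvgAt ρ A`. -/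
theorem symLinU_real (ρ : Site d) (A : Form1 d ℝ) (L : ℕ) (μ : Fin d) (y : Site d) :
    symLinU ρ A L μ y = symLinAvgAt ρ A L μ y := by
  simp only [symLinU, symLinAvgAt, symAxial, gammaPAt, List.sum_append, rev_sum, axialP_sum_real]
  rw [Finset.sum_comm]
  refine Finset.sum_congr rfl fun b _ => ?_
  simp only [Finset.sum_add_distrib, Finset.sum_neg_distrib, Finset.sum_const, Finset.card_univ, card_perm_fin, nsmul_eq_mul]
  ring

/-- [folklore] Swapping the pair form swaps the letters of the pair loops. -/
theorem loopPAt_pairForm_swap (σ σ' : Equiv.Perm (Fin d)) (ρ : Site d) (W W' : Form1 d 𝔸) (L : ℕ) (μ : Fin d) (y : Site d)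
    (b : Fin d → ℕ) : loopPAt σ σ' ρ (pairForm W' W) L μ y b = (loopPAt σ σ' ρ (pairForm W W') L μ y b).map Prod.swap := by
  rw [pairForm_swap, ← loopPAt_map]; rfl

/-- [folklore] **The symmetrised W-Hessian functional is symmetric.** -/
theorem symHessUAt_symm (ρ : Site d) (W W' : Form1 d 𝔸) (L : ℕ) (μ : Fin d) (y : Site d) :
    symHessUAt ρ W' W L μ y = symHessUAt ρ W W' L μ y := by
  simp only [symHessUAt, loopPAt_pairForm_swap _ _ ρ W W', segUp_pairForm_swap W W', cross_swap]
  abel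

end Functionals

section Counts

/-- [our object] **`LIN⁰⁴∕d!`**: `symLinCountAt ρ L μ y f = S(δ_f)` = the signed number of passages through the bond `f` of the words `γ^{σ,σ}_x`,
summed over `x ∈ B(y)` and `σ ∈ S_d` (`= d!·L^d·q¹_sym(f)`). -/
def symLinCountAt (ρ : Site d) (L : ℕ) (μ : Fin d) (y : Site d) (f : Bond d) : ℤ := symLinU ρ (δ1 f) L μ y

/-- [our object] **`WED⁰⁴`**: the pure wedge part `Σ_x Σ_{σ,σ′} wedge(loop^{σ,σ′}_x)(δ_f, δ_{f′})`. -/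
def symWedgeCountAt (ρ : Site d) (L : ℕ) (μ : Fin d) (y : Site d) (f f' : Bond d) : ℤ :=
  ∑ b ∈ box d L, ∑ σ : Equiv.Perm (Fin d), ∑ σ' : Equiv.Perm (Fin d), wedge (loopPAt σ σ' ρ (pairForm (δ1 f) (δ1 f')) L μ y b)

/-- [our object] **`HESS⁰⁴`** (`= 2(d!)²L^d · h_sym(f, f′)`): sym twin of node 7aρ `hessCountAt`. -/
def symHessCountAt (ρ : Site d) (L : ℕ) (μ : Fin d) (y : Site d) (f f' : Bond d) : ℤ :=
  symWedgeCountAt ρ L μ y f f'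
    + (d ! : ℤ) * (symLinCountAt ρ L μ y f * cCountAt ρ L μ y f' - symLinCountAt ρ L μ y f' * cCountAt ρ L μ y f)
    + (d ! : ℤ) ^ 2 * (L : ℤ) ^ d * wedge (segUp (pairForm (δ1 f) (δ1 f')) ((L : ℤ) • y + ρ) μ L)

/-- [our object] **`VH⁰⁴`** (`= 2(d!)²L^{2d} · m_sym(f, f′)`, product chart): sym twin of node 7aρ `vhCountAt`. -/
def symVhCountAt (ρ : Site d) (L : ℕ) (μ : Fin d) (y : Site d) (f f' : Bond d) : ℤ :=
  (L : ℤ) ^ d * symHessCountAt ρ L μ y f f' + (L : ℤ) ^ d * (if f = f' then (d ! : ℤ) * symLinCountAt ρ L μ y f else 0)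
    - symLinCountAt ρ L μ y f * symLinCountAt ρ L μ y f'

/-- [folklore] BRIDGE: `symLinCountAt` cast to `ℝ` is S1's `symLinAvgAt` of the real indicator form. -/
theorem symLinCountAt_real (ρ : Site d) (L : ℕ) (μ : Fin d) (y : Site d) (f : Bond d) :
    (symLinCountAt ρ L μ y f : ℝ) = symLinAvgAt ρ (mapForm (Int.castAddHom ℝ) (δ1 f)) L μ y := by
  rw [← symLinU_real, symLinU, symLinU_mapForm, symLinCountAt, symLinU]; rfl

variable {𝔸 : Type*} [Ring 𝔸]

/-- [folklore] `S(single f w) = symLinCountAt f • w`. -/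
theorem symLinU_single (ρ : Site d) (f : Bond d) (w : 𝔸) (L : ℕ) (μ : Fin d) (y : Site d) :
    symLinU ρ (single f w) L μ y = symLinCountAt ρ L μ y f • w := by
  rw [single_eq_mapForm, symLinU, symLinU_mapForm, zmultiplesHom_apply, symLinCountAt, symLinU]

/-- [folklore] **IDENTIFICATION (symmetrised W-Hessian):** `symHessUAt ρ (w·δ_f) (w′·δ_{f′}) = symHessCountAt ρ f f′ • [w, w′]`. -/
theorem symHessUAt_single (ρ : Site d) (f f' : Bond d) (w w' : 𝔸) (L : ℕ) (μ : Fin d) (y : Site d) :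
    symHessUAt ρ (single f w) (single f' w') L μ y = symHessCountAt ρ L μ y f f' • comm w w' := by
  have h1 : ∀ b σ σ', cross (loopPAt σ σ' ρ (pairForm (single f w) (single f' w')) L μ y b)
      = wedge (loopPAt σ σ' ρ (pairForm (δ1 f) (δ1 f')) L μ y b) • comm w w' := by
    intro b σ σ'
    rw [pairForm_single, ← loopPAt_map, cross_map_smulPair]
  have h2 : cross (segUp (pairForm (single f w) (single f' w')) ((L : ℤ) • y + ρ) μ L)
      = wedge (segUp (pairForm (δ1 f) (δ1 f')) ((L : ℤ) • y + ρ) μ L) • comm w w' := by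
    rw [pairForm_single, ← segUp_map, cross_map_smulPair]
  simp only [symHessUAt, h1, h2, symLinU_single, segUp_root_sum_single, comm_zsmul_zsmul, symHessCountAt, symWedgeCountAt,
    ← Finset.sum_smul, comm_anticomm w w']
  module

/-- [folklore] **IDENTIFICATION (symmetrised field–multiplier block):** `symVhUAt ρ (w·δ_f) (v·δ_{f′}) = symVhCountAt ρ f f′ • [w, v]`. -/
theorem symVhUAt_single (ρ : Site d) (f f' : Bond d) (w v : 𝔸) (L : ℕ) (μ : Fin d) (y : Site d) :
    symVhUAt ρ (single f w) (single f' v) L μ y = symVhCountAt ρ L μ y f f' • comm w v := by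
  rw [symVhUAt, symHessUAt_single, bw_single, symLinU_single, symLinU_single, symLinU_single, comm_zsmul_zsmul, symVhCountAt,
    smul_smul, sub_smul, add_smul, mul_smul ((L : ℤ) ^ d) (ite _ _ _)]
  congr 2
  split_ifs <;> simp [mul_smul, mul_comm]

/-- [folklore] `symWedgeCountAt` is ANTISYMMETRIC. -/
theorem symWedgeCountAt_swap (ρ : Site d) (L : ℕ) (μ : Fin d) (y : Site d) (f f' : Bond d) :
    symWedgeCountAt ρ L μ y f' f = -symWedgeCountAt ρ L μ y f f' := by
  have h1 : ∀ b σ σ', wedge (loopPAt σ σ' ρ (pairForm (δ1 f') (δ1 f)) L μ y b)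
      = -wedge (loopPAt σ σ' ρ (pairForm (δ1 f) (δ1 f')) L μ y b) := by
    intro b σ σ'; rw [loopPAt_pairForm_swap σ σ' ρ (δ1 f) (δ1 f'), wedge_swap]
  simp only [symWedgeCountAt, h1, Finset.sum_neg_distrib]

/-- [folklore] `symHessCountAt` is ANTISYMMETRIC. -/
theorem symHessCountAt_swap (ρ : Site d) (L : ℕ) (μ : Fin d) (y : Site d) (f f' : Bond d) :
    symHessCountAt ρ L μ y f' f = -symHessCountAt ρ L μ y f f' := by
  have h2 : wedge (segUp (pairForm (δ1 f') (δ1 f)) ((L : ℤ) • y + ρ) μ L)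
      = -wedge (segUp (pairForm (δ1 f) (δ1 f')) ((L : ℤ) • y + ρ) μ L) := by
    rw [segUp_pairForm_swap (δ1 f) (δ1 f'), wedge_swap]
  simp only [symHessCountAt, symWedgeCountAt_swap ρ L μ y f f', h2]
  ring

/-- [folklore] `symHessCountAt ρ f f = 0`. -/
@[simp] theorem symHessCountAt_self (ρ : Site d) (L : ℕ) (μ : Fin d) (y : Site d) (f : Bond d) :
    symHessCountAt ρ L μ y f f = 0 := by
  have := symHessCountAt_swap ρ L μ y f f
  omega

end Counts

end Summit.QuantumFields.BalabanUV.Beta.SymAveragingHessianCounts
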